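import Summits.BirchSwinnertonDyer.Rank1Residual.X12.ClassClosureO10EtaBranch
import Summits.BirchSwinnertonDyer.Rank1Residual.Additive.QuadraticBranchConsumersNoTorsionHyp
import Summits.BirchSwinnertonDyer.Rank1Residual.Additive.QuadraticBranchPAdicGrossZagierValuation
import Literature.NumberTheory.EllipticCurves.AnalyticRankModularityProofs
import HarnessLib

/-!
# O10-PS class node from the REFINED typed inputs: `LowerHalfOnType p I₀*` (and `BSD(W, p)` per pair)
# ⟸ C-cc-1 ∧ (C3_η) on the rank-one curves of signed type `(p, I₀*)` ∧ (C1_η) on their good twins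
# (cell `bsd-cm`, seat `bsd-cm-inert` g0; TARGET.md §1 «SMALL ASSEMBLY WANTED» R27 / W4; bookkeeping
# over the tree's theorems; nothing asserted, nothing booked)

HONEST FRAMING (cell `bsd-cm`, run/shared/lean/pub/bsd-cm/): FULL BSD for every analytic-rank `≤ 1`
curve is the programme's target of record. This file is the class-level packaging the planner asked
for (TARGET §1, R27): the O10-PS node of record `X12.O10.LowerHalfOnType p (.Istar 0)` from the
REFINED inputs — (C2_η-GZ) = C-cc-1 `QuadraticBranchPAdicGrossZagierValuationAt` and (C3_η)
`QuadraticBranchOddStrictExactControlOfPlusMCAt` on the curves of the type, (C1_η)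
`QuadraticBranchPlusMainConjectureAt` on their CM good-inert twins — through the `htors`/`hidx`-free
pair consumer `bsdp_of_quadraticBranchPAdicGrossZagierValuation_of_exactControl_model`, replacing
the older one-arrow form `lowerHalfOnType_IstarZero_of_quadraticBranch` (input (C2_η)
`QuadraticBranchRankOneLinkAt`). The DATA the pair consumer binds are PRODUCED here: the twin `V`
and `C` (`exists_goodTwist_pStar_of_hasSignedLocalType_IstarZero`), the newform (modularity
`exists_isNewformOf`, named fact `hnf`), a generator of `W(ℚ)/tors` (GZK `hGZK` + Mordell–Weil,
`exists_generator_of_mordellWeilRank_eq_one`) and its `p`-divisibility level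
(`StrictSha.exists_level_of_not_isOfFinAddOrder`); TWO analytic existence statements that the tree
does not yet carry as theorems are DISPLAYED as one binder `hdata` (honest labels): the period
ratio `ϖ ∈ ℚ` of the parity of `η` (`ϖ·Ω_V = Ω⁺_f`, resp. `ϖ·|Ω⁻(V)| = Ω⁻_f` — rationality of the
newform/Néron period ratio) and the EXISTENCE of Kobayashi's branch function `L_p⁻(V, η, X)`
(Kobayashi 2003 Thm. 3.2 = Pollack; the tree has the trivial-branch existence
`Kobayashi2003.exists_isSignedPAdicLFunction`, not the quadratic-branch one). All inputs are typed
`@[conjecture]`s or named facts; O10 stays OPEN; no label / mark / count moves.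

References (locators only): [Kobayashi2003] Thm. 3.2 (p. 7), §4 (p. 8), Thm. 7.4 (p. 13), Thm. 9.3
(p. 26); [Miller2011LMS] §1, Def. 1.1; [Tian2023CongruentICM] p. 1993; [SilvermanAEC2009] VII.6.3,
VIII.6.7.
-/

noncomputable section

open scoped Classical MatrixGroups ModularForm NumberField

open CongruenceSubgroup WeierstrassCurve Literature.NumberTheory.EllipticCurves
  Literature.NumberTheory.EllipticCurves.ModularForms
  Literature.NumberTheory.EllipticCurves.Kobayashi2003
  Literature.NumberTheory.EllipticCurves.Rank1Residual
  Literature.NumberTheory.EllipticCurves.Rank1Residual.Typed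
  Summit.BirchSwinnertonDyer.Rank1Residual.Additive

namespace Summit.BirchSwinnertonDyer.Rank1Residual.X12.O10

variable {p : ℕ} [hp : Fact p.Prime]

/-- **`BSD(W, p)` for a rank-one CM curve of signed local type `(p, I₀*)`, `p ≥ 5`, FROM the refined
typed inputs** C-cc-1 (`h2`) ∧ (C3_η) (`h3`) at `(W, p)` and (C1_η) on the CM good-inert curves
(`hC1`), given the named facts `hmod`, `hGZ`, `hGZK`, modularity `hnf`, and the displayed analytic
existence binder `hdata` (period ratio `ϖ` + a branch function `L_p⁻(V, η, X)`, Kobayashi Thm. 3.2).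
The twin, the newform, the generator and its level are produced inside. CONDITIONAL on typed
conjecture items; nothing booked. [cite: Kobayashi2003, Thm. 3.2 (p. 7), §4 (p. 8), Thm. 7.4 (p. 13)]
[cite: Miller2011LMS, §1 and Def. 1.1] [cite: SilvermanAEC2009, Prop. VII.6.3 and Thm. VIII.6.7] -/
theorem bsdp_of_hasSignedLocalType_IstarZero_of_valuation_of_exactControl
    (hmod : hasEntireLFunction_rat) (hGZ : GrossZagier1986_thm_I_7_3)
    (hGZK : rank_eq_analyticRank_of_analyticRank_le_one) (hnf : exists_isNewformOf)
    (hdata : ∀ (V : WeierstrassCurve ℚ) [V.IsElliptic] [V.IsGloballyMinimal]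
      {N : ℕ} [NeZero N] (f : CuspForm (Gamma0 N) 2), IsNewformOf V f →
      V.HasGoodReductionAtPrime p → V.frobeniusTrace p = 0 →
      ∃ ϖ : ℚ, (if Even (p / 2) then (ϖ : ℝ) * V.realPeriodRat = plusPeriod f
          else (ϖ : ℝ) * V.imaginaryPeriodRat = minusPeriod f) ∧
        ∃ L : IwasawaAlgebra p, IsQuadraticBranchMinusLFunction f p ϖ L)
    (hC1 : ∀ (V : WeierstrassCurve ℚ) [V.IsElliptic] [V.IsGloballyMinimal], V.HasCM →
      V.HasGoodReductionAtPrime p → CMInert V p → QuadraticBranchPlusMainConjectureAt V p)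
    (W : WeierstrassCurve ℚ) [W.IsElliptic] [W.IsGloballyMinimal]
    (h2 : QuadraticBranchPAdicGrossZagierValuationAt W p)
    (h3 : QuadraticBranchOddStrictExactControlOfPlusMCAt W p)
    (hT : HasSignedLocalType W p (.Istar 0)) (hr : W.analyticRank = 1) (hp5 : 5 ≤ p) :
    BSDp W p := by
  -- the good supersingular CM twin and the change of variables
  obtain ⟨V, hVe, hVm, C, hC, hgood, hap, hCM, hin, -⟩ :=
    exists_goodTwist_pStar_of_hasSignedLocalType_IstarZero W hT hp5
  -- the newform of the twin (modularity) and the displayed analytic data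
  haveI : NeZero (V.conductorNorm ℤ) := ⟨(V.conductorNorm_pos_holds).ne'⟩
  obtain ⟨f, hf⟩ := hnf V
  obtain ⟨ϖ, hϖ, L, hL⟩ := hdata V f hf hgood hap
  -- Mordell–Weil: rank one (GZK), a generator modulo torsion, and its `p`-divisibility level
  obtain ⟨hrank, -⟩ := hGZK W hr.le
  have hrank1 : W.mordellWeilRank = 1 := by rw [hrank, hr]
  obtain ⟨P, hP, hgen⟩ := exists_generator_of_mordellWeilRank_eq_one W hrank1
  obtain ⟨lam, hlam⟩ := exists_addMonoidHom_padicInt_apply_eq_zero_iff p (W.baseChange ℚ_[p])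
  have hinj : Function.Injective (W.toPadicPoint p) :=
    Affine.Point.map_injective (W' := W) (Algebra.ofId ℚ ℚ_[p])
  have hP' : ¬ IsOfFinAddOrder P := by convert hP
  have hPp : ¬ IsOfFinAddOrder (W.toPadicPoint p P) := by
    intro h
    apply hP'
    obtain ⟨m, hm, hmP⟩ := isOfFinAddOrder_iff_nsmul_eq_zero.mp h
    refine isOfFinAddOrder_iff_nsmul_eq_zero.mpr ⟨m, hm, hinj ?_⟩
    rw [map_nsmul, map_zero]
    exact hmP
  obtain ⟨n, hdiv, hndiv⟩ := StrictSha.exists_level_of_not_isOfFinAddOrder p lam hlam hPp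
  have hgen' : ∀ R : W.toAffine.Point, ∃ (k : ℤ) (T : W.toAffine.Point),
      IsOfFinAddOrder T ∧ R = k • P + T := fun R ↦ by
    obtain ⟨a, t, ht, hR⟩ := hgen R
    exact ⟨a, t, by convert ht, by convert hR⟩
  exact bsdp_of_quadraticBranchPAdicGrossZagierValuation_of_exactControl_model W p hmod hGZ hGZK
    ((quadraticBranchPAdicGrossZagierValuationAt_iff W p).mp h2) h3 hp5 hC hgood hap
    (hC1 V hCM hgood hin) hf hϖ hL hP' hgen' hdiv hndiv hr

/-- **The O10-PS node of record from the REFINED inputs: `LowerHalfOnType p I₀*`, `p ≥ 5`** ⟸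
(C-cc-1 ∧ C3_η on every rank-one CM curve of signed type `(p, I₀*)`) ∧ (C1_η on the CM good-inert
curves) — the planner's R27 shape, with the named facts `hmod hGZ hGZK hnf` and the displayed
analytic existence binder `hdata`. CONDITIONAL; nothing booked; no label moves.
[cite: Kobayashi2003, §4 (p. 8) and Thm. 3.2 (p. 7)] [cite: Tian2023CongruentICM, p. 1993]
[cite: Miller2011LMS, Def. 1.1] -/
theorem lowerHalfOnType_IstarZero_of_valuation_of_exactControl
    (hmod : hasEntireLFunction_rat) (hGZ : GrossZagier1986_thm_I_7_3)
    (hGZK : rank_eq_analyticRank_of_analyticRank_le_one) (hnf : exists_isNewformOf)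
    (hdata : ∀ (V : WeierstrassCurve ℚ) [V.IsElliptic] [V.IsGloballyMinimal]
      {N : ℕ} [NeZero N] (f : CuspForm (Gamma0 N) 2), IsNewformOf V f →
      V.HasGoodReductionAtPrime p → V.frobeniusTrace p = 0 →
      ∃ ϖ : ℚ, (if Even (p / 2) then (ϖ : ℝ) * V.realPeriodRat = plusPeriod f
          else (ϖ : ℝ) * V.imaginaryPeriodRat = minusPeriod f) ∧
        ∃ L : IwasawaAlgebra p, IsQuadraticBranchMinusLFunction f p ϖ L)
    (hIn : ∀ (W : WeierstrassCurve ℚ) [W.IsElliptic] [W.IsGloballyMinimal],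
      HasSignedLocalType W p (.Istar 0) → W.analyticRank = 1 →
        QuadraticBranchPAdicGrossZagierValuationAt W p ∧
          QuadraticBranchOddStrictExactControlOfPlusMCAt W p)
    (hC1 : ∀ (V : WeierstrassCurve ℚ) [V.IsElliptic] [V.IsGloballyMinimal], V.HasCM →
      V.HasGoodReductionAtPrime p → CMInert V p → QuadraticBranchPlusMainConjectureAt V p)
    (hp5 : 5 ≤ p) : LowerHalfOnType p (.Istar 0) :=
  lowerHalfOnType_of_forall_bsdp hGZK fun W _ _ hT hr ↦
    bsdp_of_hasSignedLocalType_IstarZero_of_valuation_of_exactControl hmod hGZ hGZK hnf hdata hC1 W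
      (hIn W hT hr).1 (hIn W hT hr).2 hT hr hp5

end Summit.BirchSwinnertonDyer.Rank1Residual.X12.O10

end
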